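import Summits.Ventures.PercRepro.RankLevelSetMinorPairInduction
import Summits.Ventures.PercRepro.RankLevelSetIndepCDOfContainSkew

/-! # RankLevelSetMinorPairInductionCD — (CD) AND (★★) ON EVERY FINITE MATROID FROM THE EQUAL-RANK SLICE (M₀)
(night-1 g29; dossier §41.5, the end of the ladder)

`RankLevelSetMinorPairInduction` reduced (CX*) = `BiContainSkew` to the equal-rank slice (M₀) =
`MinorPairEqualRankSkew` of the cumulative skew on pairs of complementary minors. Composed with the landed ladder
(CX*) on the minors ⟹ (PC) ⟹ (★★) and (CX*) on the minors ⟹ (CD): **`indepCD_of_equalRankSkew`** — (M₀) on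
every minor of `M` implies `IndepCD M` — and the «for every finite matroid» forms **`biIndepPerElem_of_equalRankSkew_all`**,
**`indepCD_of_equalRankSkew_all`** (the minors of a finite matroid are finite). So the whole chain
(M₀) ⟹ (CX*) ⟹ (PC) ⟹ (★★) ⟹ Mono and (M₀) ⟹ (CD) is in the kernel, with (M₀) — «Mono for the pairs of
complementary minors of equal rank», a statement whose `(∅, ∅)` case is the Lorentzian consequence — as the single
open input. Nothing here asserts (M₀); every declaration has a docstring; imports: the cell's own modules and Mathlib
only. Axioms: standard. -/

namespace PercRepro

open Set Matroid

variable {α : Type} (M : Matroid α) [M.Finite]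

/-- **(CD) FROM (M₀) ON THE MINORS**: `(∀ N ≤m M, MinorPairEqualRankSkew N) → IndepCD M`. -/
theorem indepCD_of_equalRankSkew (h : ∀ N : Matroid α, N ≤m M → MinorPairEqualRankSkew N) : IndepCD M :=
  indepCD_of_biContainSkew M (fun N hN =>
    haveI : N.Finite := ⟨M.ground_finite.subset hN.subset⟩
    biContainSkew_of_equalRankSkew N (h N hN))

/-- **(M₀) for every finite matroid implies (★★) for every finite matroid.** -/
theorem biIndepPerElem_of_equalRankSkew_all (hall : ∀ (N : Matroid α) [N.Finite], MinorPairEqualRankSkew N) :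
    BiIndepPerElem M :=
  biIndepPerElem_of_equalRankSkew M (fun N hN => haveI : N.Finite := ⟨M.ground_finite.subset hN.subset⟩; hall N)

/-- **(M₀) for every finite matroid implies (CD) for every finite matroid.** -/
theorem indepCD_of_equalRankSkew_all (hall : ∀ (N : Matroid α) [N.Finite], MinorPairEqualRankSkew N) :
    IndepCD M :=
  indepCD_of_equalRankSkew M (fun N hN => haveI : N.Finite := ⟨M.ground_finite.subset hN.subset⟩; hall N)

end PercRepro
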